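import Mathlib
import Literature.Claims.NS.Shahmurov2026
import HarnessLib

/-!
# D-0090 NS-CLAIMS, claim C11 `Shahmurov2026` (T = arXiv:2605.09797 v2), row #11 — BY-SLOT record, support
# block 1/3: smooth radial bumps on the lifted space `ℝ⁵` and the `z`-derivative of the Newtonian kernel

Support block for `Theorems/SoloRefuteShahmurov2026Prop52Concrete.lean` (records-grade, by-slot of #11; chair
RULINGS 2026-08-27T08:12Z (1)). Pure analysis, no claim decl is touched: (A) the smooth radial bump
`bump c r₁ r₂` (`= 1` on `closedBall c r₁`, `= 0` off `ball c r₂`, values in `[0,1]`, smooth, compactly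
supported, derivative vanishing off `closedBall c r₂`); (B) the symmetry axis `e₄` of `E5` and `SO(4)`-radiality
(`Literature.Claims.NS.Shahmurov2026.IsSO4Radial`) of axial bumps; (C) the kernel `K = ∂_zΓ` of the recovered
strain `U[g] = K * g` (`recoveredStrain`, T eq. (2.5) p.9): explicit formula off the origin
`K(X) = 2A⁻¹k(‖X‖²)^{−k−1}X_z` (`KK_eq`, from `Literature.Analysis.PDE.Newtonian.hasFDerivAt_regKernel`), hence
`K(X) < 0` for `X_z < 0` (`KK_neg`) and continuity off the origin (`continuousAt_KK`). [folklore]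
WHAT THIS IS NOT: not a claim about NS regularity or blow-up; not a claim about any author beyond the typed
locator.
-/

noncomputable section

-- The summit's canonical theorem namespace repeats the summit name (single-conjunct summit).
set_option linter.dupNamespace false

namespace Summit.NavierStokesRegularity.NavierStokesRegularity.Theorems.Shahmurov2026.Concrete

open MeasureTheory Set Filter Topology Metric
open Literature.Claims.NS.Shahmurov2026
open Literature.Analysis.PDE

/-! ### A. Smooth radial cut-offs on the lifted space `E5 = ℝ⁵` -/

/-- Smooth step in the squared radius: `cut a b s = 1` for `s ≤ a`, `cut a b s = 0` for `b ≤ s` (`a < b`),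
values in `[0,1]`, positive for `s < b`. [folklore] -/
def cut (a b s : ℝ) : ℝ := Real.smoothTransition ((b - s) / (b - a))

/-- `cut a b s = 1` for `s ≤ a`. -/
theorem cut_eq_one {a b s : ℝ} (hab : a < b) (hs : s ≤ a) : cut a b s = 1 :=
  Real.smoothTransition.one_of_one_le (by rw [le_div_iff₀ (sub_pos.2 hab)]; linarith)

/-- `cut a b s = 0` for `b ≤ s`. -/
theorem cut_eq_zero {a b s : ℝ} (hab : a < b) (hs : b ≤ s) : cut a b s = 0 :=
  Real.smoothTransition.zero_of_nonpos (div_nonpos_of_nonpos_of_nonneg (by linarith) (by linarith))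

/-- `0 ≤ cut a b s`. -/
theorem cut_nonneg (a b s : ℝ) : 0 ≤ cut a b s := Real.smoothTransition.nonneg _

/-- `cut a b s ≤ 1`. -/
theorem cut_le_one (a b s : ℝ) : cut a b s ≤ 1 := Real.smoothTransition.le_one _

/-- `0 < cut a b s` for `s < b`. -/
theorem cut_pos {a b s : ℝ} (hab : a < b) (hs : s < b) : 0 < cut a b s :=
  Real.smoothTransition.pos_of_pos (div_pos (by linarith) (by linarith))

/-- `cut a b` is smooth. -/
theorem contDiff_cut (a b : ℝ) {n : ℕ∞} : ContDiff ℝ n (cut a b) :=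
  Real.smoothTransition.contDiff.comp ((contDiff_const.sub contDiff_id).div_const _)

/-- The smooth radial bump `bump c r₁ r₂ x = cut (r₁²) (r₂²) ‖x − c‖²`: `= 1` on `closedBall c r₁`, `= 0` off
`ball c r₂`, values in `[0,1]`. [folklore] -/
def bump (c : E5) (r₁ r₂ : ℝ) (x : E5) : ℝ := cut (r₁ ^ 2) (r₂ ^ 2) (‖x - c‖ ^ 2)

section Bump

variable {c : E5} {r₁ r₂ : ℝ}

/-- `0 ≤ bump`. -/
theorem bump_nonneg (c : E5) (r₁ r₂ : ℝ) (x : E5) : 0 ≤ bump c r₁ r₂ x := cut_nonneg _ _ _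

/-- `bump ≤ 1`. -/
theorem bump_le_one (c : E5) (r₁ r₂ : ℝ) (x : E5) : bump c r₁ r₂ x ≤ 1 := cut_le_one _ _ _

/-- `0 ≤ r₁ < r₂ ⇒ r₁² < r₂²`. -/
private theorem sq_lt_sq_of (h₁ : 0 ≤ r₁) (h : r₁ < r₂) : r₁ ^ 2 < r₂ ^ 2 := by nlinarith

/-- `bump c r₁ r₂ = 1` on `closedBall c r₁`. -/
theorem bump_eq_one (h₁ : 0 ≤ r₁) (h : r₁ < r₂) {x : E5} (hx : ‖x - c‖ ≤ r₁) : bump c r₁ r₂ x = 1 :=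
  cut_eq_one (sq_lt_sq_of h₁ h) (by nlinarith [norm_nonneg (x - c)])

/-- `bump c r₁ r₂ = 0` off `ball c r₂`. -/
theorem bump_eq_zero (h₁ : 0 ≤ r₁) (h : r₁ < r₂) {x : E5} (hx : r₂ ≤ ‖x - c‖) : bump c r₁ r₂ x = 0 :=
  cut_eq_zero (sq_lt_sq_of h₁ h) (by nlinarith [norm_nonneg (x - c)])

/-- `bump c r₁ r₂ > 0` on `ball c r₂`. -/
theorem bump_pos (h₁ : 0 ≤ r₁) (h : r₁ < r₂) {x : E5} (hx : ‖x - c‖ < r₂) : 0 < bump c r₁ r₂ x :=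
  cut_pos (sq_lt_sq_of h₁ h) (by nlinarith [norm_nonneg (x - c)])

/-- Contrapositive of `bump_eq_zero`: where the bump is nonzero we are inside the ball. -/
theorem norm_lt_of_bump_ne_zero (h₁ : 0 ≤ r₁) (h : r₁ < r₂) {x : E5} (hx : bump c r₁ r₂ x ≠ 0) :
    ‖x - c‖ < r₂ := by
  by_contra h'
  exact hx (bump_eq_zero h₁ h (not_lt.1 h'))

/-- `bump c r₁ r₂` is smooth. -/
theorem contDiff_bump (c : E5) (r₁ r₂ : ℝ) {n : ℕ∞} : ContDiff ℝ n (bump c r₁ r₂) :=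
  (contDiff_cut _ _).comp ((contDiff_norm_sq ℝ).comp (contDiff_id.sub contDiff_const))

/-- `bump c r₁ r₂` is continuous. -/
theorem continuous_bump (c : E5) (r₁ r₂ : ℝ) : Continuous (bump c r₁ r₂) :=
  (contDiff_bump c r₁ r₂ (n := 0)).continuous

/-- `bump c r₁ r₂` is differentiable. -/
theorem differentiable_bump (c : E5) (r₁ r₂ : ℝ) : Differentiable ℝ (bump c r₁ r₂) :=
  (contDiff_bump c r₁ r₂ (n := 1)).differentiable (by simp)

/-- The derivative of `bump c r₁ r₂` is continuous. -/
theorem continuous_fderiv_bump (c : E5) (r₁ r₂ : ℝ) : Continuous (fderiv ℝ (bump c r₁ r₂)) :=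
  (contDiff_bump c r₁ r₂ (n := 1)).continuous_fderiv (by simp)

/-- `tsupport (bump c r₁ r₂) ⊆ closedBall c r₂`. -/
theorem tsupport_bump_subset (h₁ : 0 ≤ r₁) (h : r₁ < r₂) : tsupport (bump c r₁ r₂) ⊆ closedBall c r₂ := by
  refine closure_minimal (fun x hx => ?_) isClosed_closedBall
  rw [mem_closedBall, dist_eq_norm]
  exact (norm_lt_of_bump_ne_zero h₁ h hx).le

/-- `bump c r₁ r₂` has compact support. -/
theorem hasCompactSupport_bump (h₁ : 0 ≤ r₁) (h : r₁ < r₂) : HasCompactSupport (bump c r₁ r₂) :=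
  HasCompactSupport.intro (isCompact_closedBall c r₂) fun x hx => by
    rw [mem_closedBall, dist_eq_norm, not_le] at hx
    exact bump_eq_zero h₁ h hx.le

/-- Off the closed ball the bump vanishes identically near the point. -/
theorem bump_eventuallyEq_zero (h₁ : 0 ≤ r₁) (h : r₁ < r₂) {x : E5} (hx : r₂ < ‖x - c‖) :
    bump c r₁ r₂ =ᶠ[𝓝 x] 0 := by
  refine notMem_tsupport_iff_eventuallyEq.1 fun hm => ?_
  have := tsupport_bump_subset h₁ h hm
  rw [mem_closedBall, dist_eq_norm] at this
  exact absurd hx (not_lt.2 this)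

/-- The derivative of `bump c r₁ r₂` vanishes off `closedBall c r₂`. -/
theorem fderiv_bump_eq_zero (h₁ : 0 ≤ r₁) (h : r₁ < r₂) {x : E5} (hx : r₂ < ‖x - c‖) :
    fderiv ℝ (bump c r₁ r₂) x = 0 := by
  rw [(bump_eventuallyEq_zero h₁ h hx).fderiv_eq]
  simp

end Bump

/-! ### B. Lifted coordinates: the symmetry axis `e₄`, `SO(4)`-radiality of axial bumps -/

/-- The unit vector of the symmetry (`z`-)axis of the lifted space, `e₄ = (0,0,0,0,1)`. -/
def e₄ : E5 := EuclideanSpace.single 4 1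

/-- `(e₄)_z = 1`. -/
@[simp] theorem e₄_apply_four : e₄ 4 = 1 := by simp [e₄]

/-- `⟪x, e₄⟫ = x_z`. -/
theorem inner_e₄ (x : E5) : inner ℝ x e₄ = x 4 := by
  simp [e₄, EuclideanSpace.inner_single_right]

/-- `(t e₄)_z = t`. -/
@[simp] theorem smul_e₄_apply_four (t : ℝ) : (t • e₄) 4 = t := by simp [e₄]

/-- `‖t e₄‖ = |t|`. -/
theorem norm_smul_e₄ (t : ℝ) : ‖t • e₄‖ = |t| := by
  simp [e₄, norm_smul]

/-- `|x_z − c_z| ≤ ‖x − c‖`. -/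
theorem abs_sub_four_le (x c : E5) : |x 4 - c 4| ≤ ‖x - c‖ := by
  have h := PiLp.norm_apply_le (x - c) 4
  simpa [Real.norm_eq_abs] using h

/-- A bump centred on the axis is `SO(4)`-radial (depends on `‖x‖` and `x_z` only). -/
theorem isSO4Radial_bump (t r₁ r₂ : ℝ) : IsSO4Radial (bump (t • e₄) r₁ r₂) := by
  intro x y hn h4
  simp only [bump]
  rw [norm_sub_sq_real, norm_sub_sq_real, real_inner_smul_right, real_inner_smul_right, inner_e₄,
    inner_e₄, hn, h4]

/-- Constant multiples of `SO(4)`-radial functions are `SO(4)`-radial. -/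
theorem isSO4Radial_constMul {f : E5 → ℝ} (hf : IsSO4Radial f) (a : ℝ) :
    IsSO4Radial fun x => a * f x := fun x y hn h4 => by
  show a * f x = a * f y
  rw [hf x y hn h4]

/-! ### C. The `z`-derivative of the Newtonian kernel of `ℝ⁵`: sign and continuity off the origin -/

/-- `dim ℝ⁵ = 5 ≥ 3` (the Newtonian-kernel facts are stated for dimension `≥ 3`). -/
theorem three_le_finrank_E5 : 3 ≤ Module.finrank ℝ E5 := by
  rw [finrank_euclideanSpace_fin]; norm_num

/-- `K(X) = ∂_z Γ(X) = DΓ(X)·e₄`, the kernel of the recovered strain `U[g] = K * g` (`recoveredStrain`). -/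
def KK (X : E5) : ℝ := (fderiv ℝ (Newtonian.kernel (E := E5) 0) X) e₄

/-- Explicit formula off the origin: `K(X) = 2A⁻¹k (‖X‖²)^{-k-1} X_z` (`A = bumpMass`, `k = expo = 3/2`). -/
theorem KK_eq {X : E5} (hX : X ≠ 0) :
    KK X = 2 * (Newtonian.bumpMass E5)⁻¹ * Newtonian.expo E5 *
      (‖X‖ ^ 2) ^ (-Newtonian.expo E5 - 1) * X 4 := by
  have hb : 0 < ‖X‖ ^ 2 + 0 := Newtonian.base_pos_of_ne le_rfl hX
  have e : (Newtonian.kernel (E := E5) 0) = fun Y => -(Newtonian.bumpMass E5)⁻¹ * Newtonian.regKernel 0 Y :=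
    rfl
  have hd := (Newtonian.hasFDerivAt_regKernel hb).const_mul (-(Newtonian.bumpMass E5)⁻¹)
  rw [KK, e, hd.fderiv]
  simp only [smul_apply, innerSL_apply_apply, smul_eq_mul, add_zero, inner_e₄]
  ring

/-- The scalar coefficient in `KK_eq` is positive. -/
theorem KK_coef_pos {X : E5} (hX : X ≠ 0) :
    0 < 2 * (Newtonian.bumpMass E5)⁻¹ * Newtonian.expo E5 * (‖X‖ ^ 2) ^ (-Newtonian.expo E5 - 1) := by
  have hA := Newtonian.bumpMass_pos three_le_finrank_E5
  have hk := Newtonian.expo_pos three_le_finrank_E5 (E := E5)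
  have hn : 0 < ‖X‖ ^ 2 := by positivity
  have hr : 0 < (‖X‖ ^ 2) ^ (-Newtonian.expo E5 - 1) := Real.rpow_pos_of_pos hn _
  positivity

/-- Below the source (`X_z < 0`) the kernel is negative. -/
theorem KK_neg {X : E5} (h4 : X 4 < 0) : KK X < 0 := by
  have hX : X ≠ 0 := fun h => by simp [h] at h4
  rw [KK_eq hX]
  exact mul_neg_of_pos_of_neg (KK_coef_pos hX) h4

/-- `K` is continuous off the origin. -/
theorem continuousAt_KK {X : E5} (hX : X ≠ 0) : ContinuousAt KK X := by
  have h1 : ContDiffAt ℝ 1 (Newtonian.kernel (E := E5) 0) X := Newtonian.contDiffAt_kernel le_rfl hX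
  have h2 : ContinuousAt (fderiv ℝ (Newtonian.kernel (E := E5) 0)) X :=
    (h1.fderiv_right (m := 0) (by simp)).continuousAt
  exact h2.clm_apply continuousAt_const

end Summit.NavierStokesRegularity.NavierStokesRegularity.Theorems.Shahmurov2026.Concrete

end

-- WHAT THIS IS NOT: not a claim about NS regularity or blow-up; not a claim about any author beyond the
-- typed locator.
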